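import Summits.BirchSwinnertonDyer.Rank1Residual.GaloisImage.CyclotomicGroupRingEvaluation
import Summits.BirchSwinnertonDyer.Rank1Residual.GaloisImage.KatoExpStarFiniteLevel
import Summits.BirchSwinnertonDyer.Rank1Residual.GaloisImage.KatoZetaValueEquivariance
import HarnessLib

/-!
# The group ring `ℤ_p[(ℤ/n)ˣ]` evaluated in `ℚ_p ⊗_ℚ ℚ(ζ_n)`: the `1 ⊗ σ_b` action, the tensor-level
# derivative operator, the lattice `ℤ_p ⊗ ℤ[ζ_n]` and congruences mod `p^K`
# (cell `b2b-bsdres`, team n1011, ROUTE-1 PORT (P-KIM); OWNERS row T-PKEV, file E-B; seat p02 GEN 12)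

HONEST FRAMING (cell `b2b-bsdres`, run/shared/lean/b2b/bsd-rank1-residual/, verbatim in every
file): the goal of the cell is to DELETE the COMBINATION-SHAPED residual classes of the
Birch–Swinnerton-Dyer formula for ALL analytic-rank `≤ 1` elliptic curves over `ℚ` — "full BSD
formula for every rank `≤ 1` curve in class `C`" assembled STRICTLY from published theorems — so
that the rank-`≤ 1` remainder becomes exactly the CONSTRUCTION-SHAPED classes, which are TYPED
(missing-input `Prop`s), NOT attempted. This is not "finishing BSD". Team n1011 (N10/N11; ROUTE 1,
the PORT anatomy (P-KIM) of class X4 ∧ `p = 3`): research route on CONSTRUCTION-SHAPED classes;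
prove what is provable now; no claim beyond stated classes; census output = EVIDENCE, never a
Literature fact; RESIDUAL-MAP marks UNCHANGED; nothing is booked by this file. TOOL THEOREMS ONLY:
no definition, no named fact, no instance, no `sorry`.

## What

File E-A (`CyclotomicGroupRingEvaluation.lean`) lets `ℚ[(ℤ/n)ˣ]` act on `ℚ(ζ_n)`.  This file is its
`p`-adic twin: a group-ring element `Θ ∈ ℤ_p[(ℤ/n)ˣ]` (a `p`-integral structure in PK-3's sense —
`MazurTateDerivative.mapRingHom_padicLift_mul_prod_deriv_eq_kuriharaNumber_smul` binds one for the
Mazur–Tate element) is EVALUATED in `ℚ_p ⊗_ℚ ℚ(ζ_n)` as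
`ev_p(Θ) := Σ_{g ∈ (ℤ/n)ˣ} (Θ_g : ℚ_p) ⊗ σ_g ζ_n` (written out; no definition is introduced), and:

* §1 `exists_monoidHom_eq_baseChange_sigma` / `lift_apply_one_tmul_eq_sum` / `sum_coeff_mul_tmul_sigma`
  — `ℚ_p[(ℤ/n)ˣ]` acts `ℚ_p`-linearly on `ℚ_p ⊗ ℚ(ζ_n)` through `1 ⊗ σ_g` (Mathlib `LinearMap.baseChange`
  of `σ_g`, which agrees pointwise with the tree's `Algebra.TensorProduct.map (AlgHom.id ℚ ℚ_p) σ_g`: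
  `baseChange_sigma_apply`), multiplicatively;
* §2 ★ `sum_coeff_mul_prod_deriv_tmul_sigma` — the group-ring derivative `∏_{i∈s} Σ_{j : Fin N_i} δ_{b_i^j}·j`
  with `ℚ_p`-coefficients acts as PK-1's / THEOREM A3's TENSOR-level operator
  `s.noncommProd (i ↦ Σ_{j ∈ range N_i} (j : End_ℚ) * (1 ⊗ σ_{b_i}) ^ j)` (any finite index set `s`) — the heterogeneous
  `ℚ_p`-linear-versus-`ℚ`-linear bookkeeping is the ring-free `ZetaValue.addMonoidHom_apply_noncommProd_deriv`;
* §3 `sum_tmul_sigma_zeta_mem_cycIntLattice` — `ev_p` of a `ℤ_p`-valued coefficient vector lies in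
  PK-5's lattice `L_int = cycIntLattice p n` (`ℤ_p ⊗ ℤ[ζ_n]`); ★
  `exists_mem_cycIntLattice_sub_eq_pow_smul_of_mapRingHom_eq` — two elements of `ℤ_p[(ℤ/n)ˣ]` with the
  same image in `(ℤ/p^K)[(ℤ/n)ˣ]` evaluate to elements congruent modulo `p^K · L_int`;
  `sum_tmul_sigma_zeta_smul_sum_single` — the norm element `c · Σ_g δ_g` evaluates to the SCALAR
  `(c · μ(n)) ⊗ 1` (Ramanujan's sum, file E-A);
* the MAIN GLUE "PK-3's identity in, PK-5's premise `hval` out" built on §1–§3 is file E-C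
  `CyclotomicGroupRingDerivativeGlue.lean`.

Consumers BY NAME: PK-6 at a general level (p13 `skel/T-PORT-1-PKIM.md` v0.4 item (11): the `hval`
conjunct), PK-4b (p15 / r1 R1-71 D-55-3 (a)).  HONEST LIMITS: pure algebra; no `ZetaBody`, no Euler
system, no `exp*`, no modular symbol, no Kolyvagin statement is used or proved; the identity
`Θ̄·∏D = c·∏Nrm` is a HYPOTHESIS here (PK-3 proves it for the Mazur–Tate element); closes nothing;
books nothing; 0 defs / 0 facts.

References: K. Rubin, *Euler Systems* (2000) Def. 4.4.1 [Rubin2000]; C.-H. Kim, AJM 148 (2026) =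
arXiv:2203.12159, proof of Thm. 3.13 (the passage "`E_p(σ_p)·D_n(Σ_a ζ_n^a [a/n]⁺) ∈ ℚ_p ⊗ ℚ(μ_n)`",
v3 pp. 26–28) [Kim2022StructureSelmer]; C.-H. Kim, K. Nakamura, JNT 210 (2020) Prop. 3.5
(`∏ Nrm_ℓ ↦ Σ_{(b,n)=1} ζ_n^b = μ(n)`) [KimNakamura2020]; group-ring bookkeeping [folklore].
-/

noncomputable section

open scoped BigOperators TensorProduct
open Finset

namespace Summit.BirchSwinnertonDyer.Rank1Residual.GaloisImage

namespace GroupRingEval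

open Literature.NumberTheory.EllipticCurves.Kato2004.EulerSystemValues

variable (p : ℕ) [Fact p.Prime] (n : ℕ) [NeZero n]

/-! ### §1 `ℚ_p[(ℤ/n)ˣ]` acts on `ℚ_p ⊗_ℚ ℚ(ζ_n)` through the `1 ⊗ σ_b` -/

/-- `1 ⊗ σ_g` as the base change of `σ_g` agrees pointwise with the tree's
`Algebra.TensorProduct.map (AlgHom.id ℚ ℚ_p) σ_g` (PK-1 / `ZetaBody` C3a spelling). [folklore] -/
theorem baseChange_sigma_apply (g : (ZMod n)ˣ) (v : ℚ_[p] ⊗[ℚ] CyclotomicField n ℚ) :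
    ((sigma n g : CyclotomicField n ℚ →ₐ[ℚ] CyclotomicField n ℚ).toLinearMap.baseChange ℚ_[p]) v =
      Algebra.TensorProduct.map (AlgHom.id ℚ ℚ_[p])
        (sigma n g : CyclotomicField n ℚ →ₐ[ℚ] CyclotomicField n ℚ) v := by
  induction v using TensorProduct.induction_on with
  | zero => rw [map_zero, map_zero]
  | tmul a z =>
    rw [LinearMap.baseChange_tmul, Algebra.TensorProduct.map_tmul, AlgHom.coe_id, id_eq,
      AlgHom.toLinearMap_apply]
  | add u w hu hw => rw [map_add, map_add, hu, hw]

/-- The `1 ⊗ σ_g` assemble to a monoid homomorphism `(ℤ/n)ˣ → End_{ℚ_p}(ℚ_p ⊗ ℚ(ζ_n))`.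
Existence only — no definition is introduced. [cite: Kato2004Asterisque, (5.7.1) (p. 157)] -/
theorem exists_monoidHom_eq_baseChange_sigma :
    ∃ Ψ : (ZMod n)ˣ →* Module.End ℚ_[p] (ℚ_[p] ⊗[ℚ] CyclotomicField n ℚ),
      ∀ g, Ψ g = (sigma n g : CyclotomicField n ℚ →ₐ[ℚ] CyclotomicField n ℚ).toLinearMap.baseChange
        ℚ_[p] := by
  obtain ⟨Φ, hΦ⟩ := exists_monoidHom_eq_sigma n
  refine ⟨{ toFun := fun g =>
              (sigma n g : CyclotomicField n ℚ →ₐ[ℚ] CyclotomicField n ℚ).toLinearMap.baseChange ℚ_[p]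
            map_one' := ?_
            map_mul' := ?_ }, fun g => rfl⟩
  · have h1 : (sigma n 1 : CyclotomicField n ℚ →ₐ[ℚ] CyclotomicField n ℚ).toLinearMap =
        LinearMap.id := by
      rw [← hΦ, map_one]; rfl
    rw [h1, LinearMap.baseChange_id]
    rfl
  · intro a b
    have hab : (sigma n (a * b) : CyclotomicField n ℚ →ₐ[ℚ] CyclotomicField n ℚ).toLinearMap =
        (sigma n a : CyclotomicField n ℚ →ₐ[ℚ] CyclotomicField n ℚ).toLinearMap ∘ₗ
          (sigma n b : CyclotomicField n ℚ →ₐ[ℚ] CyclotomicField n ℚ).toLinearMap := by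
      rw [← hΦ, ← hΦ, ← hΦ, map_mul]; rfl
    change _ = _ * _
    rw [hab, LinearMap.baseChange_comp]
    rfl

/-- The algebra homomorphism `ℚ_p[(ℤ/n)ˣ] → End_{ℚ_p}(ℚ_p ⊗ ℚ(ζ_n))` induced by the `1 ⊗ σ_g` sends
`Ξ = Σ_g Ξ_g δ_g` to `v ↦ Σ_g Ξ_g • (1 ⊗ σ_g) v`. [folklore] -/
theorem lift_apply_eq_sum_padic {Ψ : (ZMod n)ˣ →* Module.End ℚ_[p] (ℚ_[p] ⊗[ℚ] CyclotomicField n ℚ)}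
    (hΨ : ∀ g, Ψ g = (sigma n g : CyclotomicField n ℚ →ₐ[ℚ] CyclotomicField n ℚ).toLinearMap.baseChange
      ℚ_[p]) (Ξ : MonoidAlgebra ℚ_[p] (ZMod n)ˣ) (v : ℚ_[p] ⊗[ℚ] CyclotomicField n ℚ) :
    MonoidAlgebra.lift ℚ_[p] (Module.End ℚ_[p] (ℚ_[p] ⊗[ℚ] CyclotomicField n ℚ)) (ZMod n)ˣ Ψ Ξ v =
      ∑ g : (ZMod n)ˣ, Ξ.coeff g • Algebra.TensorProduct.map (AlgHom.id ℚ ℚ_[p])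
        (sigma n g : CyclotomicField n ℚ →ₐ[ℚ] CyclotomicField n ℚ) v := by
  rw [MonoidAlgebra.lift_apply, Finsupp.sum_fintype _ _ (fun g => by rw [zero_smul]),
    LinearMap.sum_apply]
  refine Finset.sum_congr rfl fun g _ => ?_
  rw [LinearMap.smul_apply, hΨ, baseChange_sigma_apply]

/-- At a pure tensor `1 ⊗ z` the action is the EVALUATION `Σ_g Ξ_g ⊗ σ_g z`. [folklore] -/
theorem lift_apply_one_tmul_eq_sum
    {Ψ : (ZMod n)ˣ →* Module.End ℚ_[p] (ℚ_[p] ⊗[ℚ] CyclotomicField n ℚ)}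
    (hΨ : ∀ g, Ψ g = (sigma n g : CyclotomicField n ℚ →ₐ[ℚ] CyclotomicField n ℚ).toLinearMap.baseChange
      ℚ_[p]) (Ξ : MonoidAlgebra ℚ_[p] (ZMod n)ˣ) (z : CyclotomicField n ℚ) :
    MonoidAlgebra.lift ℚ_[p] (Module.End ℚ_[p] (ℚ_[p] ⊗[ℚ] CyclotomicField n ℚ)) (ZMod n)ˣ Ψ Ξ
        ((1 : ℚ_[p]) ⊗ₜ[ℚ] z) =
      ∑ g : (ZMod n)ˣ, Ξ.coeff g ⊗ₜ[ℚ] sigma n g z := by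
  rw [lift_apply_eq_sum_padic p n hΨ]
  refine Finset.sum_congr rfl fun g _ => ?_
  rw [Algebra.TensorProduct.map_tmul, AlgHom.coe_id, id_eq, TensorProduct.smul_tmul', smul_eq_mul,
    mul_one]
  rfl

/-- **The `p`-adic action is multiplicative**:
`Σ_g (Ξ·Ξ′)_g ⊗ σ_g z = Σ_g Ξ_g • (1 ⊗ σ_g)(Σ_h Ξ′_h ⊗ σ_h z)`. [folklore] -/
theorem sum_coeff_mul_tmul_sigma (Ξ Ξ' : MonoidAlgebra ℚ_[p] (ZMod n)ˣ) (z : CyclotomicField n ℚ) :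
    ∑ g : (ZMod n)ˣ, (Ξ * Ξ').coeff g ⊗ₜ[ℚ] sigma n g z =
      ∑ g : (ZMod n)ˣ, Ξ.coeff g • Algebra.TensorProduct.map (AlgHom.id ℚ ℚ_[p])
        (sigma n g : CyclotomicField n ℚ →ₐ[ℚ] CyclotomicField n ℚ)
          (∑ h : (ZMod n)ˣ, Ξ'.coeff h ⊗ₜ[ℚ] sigma n h z) := by
  obtain ⟨Ψ, hΨ⟩ := exists_monoidHom_eq_baseChange_sigma p n
  rw [← lift_apply_one_tmul_eq_sum p n hΨ, ← lift_apply_one_tmul_eq_sum p n hΨ,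
    ← lift_apply_eq_sum_padic p n hΨ, map_mul, Module.End.mul_apply]

/-! ### §2 The derivative with `ℚ_p`-coefficients acts as PK-1's tensor-level operator -/

/-- **★ The group-ring derivative acts as PK-1's TENSOR-level derivative operator.**  For units
`b_i ∈ (ℤ/n)ˣ` and lengths `N_i`:
`Σ_g (Ξ·∏_i Σ_{j : Fin N_i} δ_{b_i^j}·j)_g ⊗ σ_g z = (∏_i Σ_{j<N_i} j·(1 ⊗ σ_{b_i})^j)(Σ_g Ξ_g ⊗ σ_g z)`, the
right-hand operator being PK-1's `noncommProd` of `ℚ`-linear endomorphisms of `ℚ_p ⊗ ℚ(ζ_n)`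
(`ZetaValue.zetaBody_apply_deriv_zeta_eq_tmul`'s shape). [cite: Rubin2000, Def. 4.4.1] -/
theorem sum_coeff_mul_prod_deriv_tmul_sigma {ι : Type*} (s : Finset ι)
    (b : ι → (ZMod n)ˣ) (N : ι → ℕ) (Ξ : MonoidAlgebra ℚ_[p] (ZMod n)ˣ) (z : CyclotomicField n ℚ)
    (comm : (s : Set ι).Pairwise fun i i' => Commute
      (∑ j ∈ Finset.range (N i), (j : Module.End ℚ (ℚ_[p] ⊗[ℚ] CyclotomicField n ℚ)) *
        (Algebra.TensorProduct.map (AlgHom.id ℚ ℚ_[p])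
          (sigma n (b i) : CyclotomicField n ℚ →ₐ[ℚ] CyclotomicField n ℚ)).toLinearMap ^ j)
      (∑ j ∈ Finset.range (N i'), (j : Module.End ℚ (ℚ_[p] ⊗[ℚ] CyclotomicField n ℚ)) *
        (Algebra.TensorProduct.map (AlgHom.id ℚ ℚ_[p])
          (sigma n (b i') : CyclotomicField n ℚ →ₐ[ℚ] CyclotomicField n ℚ)).toLinearMap ^ j)) :
    ∑ g : (ZMod n)ˣ, (Ξ * ∏ i ∈ s, ∑ j : Fin (N i),
        MonoidAlgebra.single (b i ^ (j : ℕ)) ((j : ℕ) : ℚ_[p])).coeff g ⊗ₜ[ℚ] sigma n g z =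
      (s.noncommProd (fun i => ∑ j ∈ Finset.range (N i),
        (j : Module.End ℚ (ℚ_[p] ⊗[ℚ] CyclotomicField n ℚ)) *
          (Algebra.TensorProduct.map (AlgHom.id ℚ ℚ_[p])
            (sigma n (b i) : CyclotomicField n ℚ →ₐ[ℚ] CyclotomicField n ℚ)).toLinearMap ^ j) comm)
        (∑ g : (ZMod n)ˣ, Ξ.coeff g ⊗ₜ[ℚ] sigma n g z) := by
  obtain ⟨Ψ, hΨ⟩ := exists_monoidHom_eq_baseChange_sigma p n
  rw [← lift_apply_one_tmul_eq_sum p n hΨ, ← lift_apply_one_tmul_eq_sum p n hΨ, mul_comm, map_mul,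
    Module.End.mul_apply]
  -- the `ℚ_p`-linear operator `lift Ψ (∏ D_i)` is a `noncommProd` of the `Σ_j j (1 ⊗ σ_{b_i})^j`
  have hD : MonoidAlgebra.lift ℚ_[p] (Module.End ℚ_[p] (ℚ_[p] ⊗[ℚ] CyclotomicField n ℚ)) (ZMod n)ˣ Ψ
      (∏ i ∈ s, ∑ j : Fin (N i), MonoidAlgebra.single (b i ^ (j : ℕ)) ((j : ℕ) : ℚ_[p])) =
      s.noncommProd (fun i => ∑ j ∈ Finset.range (N i),
        (j : Module.End ℚ_[p] (ℚ_[p] ⊗[ℚ] CyclotomicField n ℚ)) * Ψ (b i) ^ j)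
        (fun i _ i' _ _ => Derivative.commute_deriv_deriv (σ := fun i => Ψ (b i))
          (fun i i' => (Commute.all (b i) (b i')).map Ψ) N i i') := by
    rw [← Finset.noncommProd_eq_prod, Finset.map_noncommProd]
    refine Finset.noncommProd_congr rfl (fun i _ => ?_) _
    rw [map_sum, Finset.sum_range (fun j =>
      (j : Module.End ℚ_[p] (ℚ_[p] ⊗[ℚ] CyclotomicField n ℚ)) * Ψ (b i) ^ j)]
    refine Finset.sum_congr rfl fun j _ => ?_
    rw [MonoidAlgebra.lift_single, map_pow, Nat.cast_smul_eq_nsmul, nsmul_eq_mul]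
  rw [hD]
  -- transfer `ℚ_p`-linear `noncommProd` ↦ PK-1's `ℚ`-linear `noncommProd` (same underlying maps)
  have hinter : ∀ i ∈ s, ∀ v : ℚ_[p] ⊗[ℚ] CyclotomicField n ℚ,
      AddMonoidHom.id (ℚ_[p] ⊗[ℚ] CyclotomicField n ℚ) (Ψ (b i) v) =
        (Algebra.TensorProduct.map (AlgHom.id ℚ ℚ_[p])
          (sigma n (b i) : CyclotomicField n ℚ →ₐ[ℚ] CyclotomicField n ℚ)).toLinearMap
          (AddMonoidHom.id (ℚ_[p] ⊗[ℚ] CyclotomicField n ℚ) v) := by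
    intro i _ v
    rw [AddMonoidHom.id_apply, AddMonoidHom.id_apply, hΨ, baseChange_sigma_apply]
    rfl
  exact ZetaValue.addMonoidHom_apply_noncommProd_deriv
    (AddMonoidHom.id (ℚ_[p] ⊗[ℚ] CyclotomicField n ℚ)) (fun i => Ψ (b i))
    (fun i => (Algebra.TensorProduct.map (AlgHom.id ℚ ℚ_[p])
      (sigma n (b i) : CyclotomicField n ℚ →ₐ[ℚ] CyclotomicField n ℚ)).toLinearMap)
    N s hinter _ _ _

/-! ### §3 `ℤ_p`-valued coefficients: the lattice `L_int`, congruences mod `p^K`, the norm element -/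

set_option backward.isDefEq.respectTransparency false in
/-- `w ⊗ z^j ∈ L_int` for `w ∈ ℤ_p` and a power `z^j` of the distinguished root `ζ_n`. [folklore] -/
theorem coe_tmul_zeta_pow_mem_cycIntLattice (w : ℤ_[p]) (j : ℕ) :
    ((w : ℤ_[p]) : ℚ_[p]) ⊗ₜ[ℚ] (IsCyclotomicExtension.zeta n ℚ (CyclotomicField n ℚ) ^ j) ∈
      cycIntLattice p n := by
  have h : ((w : ℤ_[p]) : ℚ_[p]) ⊗ₜ[ℚ] (IsCyclotomicExtension.zeta n ℚ (CyclotomicField n ℚ) ^ j) =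
      w • (((1 : ℚ_[p]) ⊗ₜ[ℚ] IsCyclotomicExtension.zeta n ℚ (CyclotomicField n ℚ)) ^ j) := by
    rw [Algebra.TensorProduct.tmul_pow, one_pow, TensorProduct.smul_tmul', Algebra.smul_def, mul_one]
    rfl
  rw [h]
  exact Submodule.smul_mem _ _ (one_tmul_zeta_pow_mem_cycIntLattice p n j)

set_option backward.isDefEq.respectTransparency false in
/-- `w ⊗ 1 ∈ L_int` for `w ∈ ℤ_p` (the scalars of `hval`'s slack). [folklore] -/
theorem coe_tmul_one_mem_cycIntLattice (w : ℤ_[p]) :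
    ((w : ℤ_[p]) : ℚ_[p]) ⊗ₜ[ℚ] (1 : CyclotomicField n ℚ) ∈ cycIntLattice p n := by
  have h := coe_tmul_zeta_pow_mem_cycIntLattice p n w 0
  rwa [pow_zero] at h

set_option backward.isDefEq.respectTransparency false in
/-- **`ev_p` of a `ℤ_p`-valued coefficient vector lies in `L_int = ℤ_p ⊗ ℤ[ζ_n]`**:
`Σ_g (w_g : ℚ_p) ⊗ σ_g ζ_n ∈ cycIntLattice p n` (`σ_g ζ_n = ζ_n^g`, Kato (5.7.1)). [folklore] -/
theorem sum_tmul_sigma_zeta_mem_cycIntLattice (w : (ZMod n)ˣ → ℤ_[p]) :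
    ∑ g : (ZMod n)ˣ, ((w g : ℤ_[p]) : ℚ_[p]) ⊗ₜ[ℚ]
        sigma n g (IsCyclotomicExtension.zeta n ℚ (CyclotomicField n ℚ)) ∈ cycIntLattice p n := by
  refine Submodule.sum_mem _ fun g _ => ?_
  rw [sigma_apply_zeta]
  exact coe_tmul_zeta_pow_mem_cycIntLattice p n (w g) _

set_option backward.isDefEq.respectTransparency false in
/-- `ev_p` of an element of `ℤ_p[(ℤ/n)ˣ]` lies in `L_int`. [folklore] -/
theorem sum_coeff_tmul_sigma_zeta_mem_cycIntLattice (Θ : MonoidAlgebra ℤ_[p] (ZMod n)ˣ) :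
    ∑ g : (ZMod n)ˣ, ((Θ.coeff g : ℤ_[p]) : ℚ_[p]) ⊗ₜ[ℚ]
        sigma n g (IsCyclotomicExtension.zeta n ℚ (CyclotomicField n ℚ)) ∈ cycIntLattice p n :=
  sum_tmul_sigma_zeta_mem_cycIntLattice p n fun g => Θ.coeff g

set_option backward.isDefEq.respectTransparency false in
/-- **★ Congruent group-ring elements have congruent values**: if `Θ, Θ′ ∈ ℤ_p[(ℤ/n)ˣ]` have the same
image in `(ℤ/p^K)[(ℤ/n)ˣ]`, then `ev_p Θ − ev_p Θ′ ∈ p^K · L_int`. [folklore] -/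
theorem exists_mem_cycIntLattice_sub_eq_pow_smul_of_mapRingHom_eq (K : ℕ)
    (Θ Θ' : MonoidAlgebra ℤ_[p] (ZMod n)ˣ)
    (h : MonoidAlgebra.mapRingHom (ZMod n)ˣ (PadicInt.toZModPow K) Θ =
      MonoidAlgebra.mapRingHom (ZMod n)ˣ (PadicInt.toZModPow K) Θ') :
    ∃ l ∈ cycIntLattice p n,
      ∑ g : (ZMod n)ˣ, ((Θ.coeff g : ℤ_[p]) : ℚ_[p]) ⊗ₜ[ℚ]
          sigma n g (IsCyclotomicExtension.zeta n ℚ (CyclotomicField n ℚ)) -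
        ∑ g : (ZMod n)ˣ, ((Θ'.coeff g : ℤ_[p]) : ℚ_[p]) ⊗ₜ[ℚ]
          sigma n g (IsCyclotomicExtension.zeta n ℚ (CyclotomicField n ℚ)) =
        ((p : ℤ_[p]) ^ K) • l := by
  -- coefficientwise: `Θ_g − Θ′_g ∈ ker (toZModPow K) = (p^K)`
  have hcoef : ∀ g : (ZMod n)ˣ, ∃ w : ℤ_[p], w * (p : ℤ_[p]) ^ K = Θ.coeff g - Θ'.coeff g := by
    intro g
    have hg := congrArg (fun X => MonoidAlgebra.coeff X g) h
    simp only [MonoidAlgebra.coeff_mapRingHom] at hg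
    have hmem : Θ.coeff g - Θ'.coeff g ∈ RingHom.ker (PadicInt.toZModPow K) := by
      rw [RingHom.mem_ker, map_sub, hg, sub_self]
    rw [PadicInt.ker_toZModPow] at hmem
    exact Ideal.mem_span_singleton'.1 hmem
  choose w hw using hcoef
  refine ⟨∑ g : (ZMod n)ˣ, ((w g : ℤ_[p]) : ℚ_[p]) ⊗ₜ[ℚ]
      sigma n g (IsCyclotomicExtension.zeta n ℚ (CyclotomicField n ℚ)),
    sum_tmul_sigma_zeta_mem_cycIntLattice p n w, ?_⟩
  rw [← Finset.sum_sub_distrib, Finset.smul_sum]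
  refine Finset.sum_congr rfl fun g _ => ?_
  rw [← TensorProduct.sub_tmul, ← PadicInt.coe_sub, ← hw g, TensorProduct.smul_tmul',
    Algebra.smul_def, PadicInt.coe_mul, mul_comm]
  rfl

omit [NeZero n] in
/-- `a ⊗ m = (a·m) ⊗ 1` in `ℚ_p ⊗_ℚ ℚ(ζ_n)` for an integer `m`. [folklore] -/
theorem tmul_intCast_eq (a : ℚ_[p]) (m : ℤ) :
    a ⊗ₜ[ℚ] ((m : ℤ) : CyclotomicField n ℚ) = (a * (m : ℚ_[p])) ⊗ₜ[ℚ] (1 : CyclotomicField n ℚ) := by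
  have hm : ((m : ℤ) : CyclotomicField n ℚ) = (m : ℚ) • (1 : CyclotomicField n ℚ) := by
    rw [Rat.smul_one_eq_cast, Rat.cast_intCast]
  rw [hm, ← TensorProduct.smul_tmul, Algebra.smul_def, eq_ratCast, Rat.cast_intCast, mul_comm]

set_option backward.isDefEq.respectTransparency false in
/-- **The norm element evaluates to a scalar**: `ev_p(c · Σ_g δ_g) = (c · μ(n)) ⊗ 1` (Ramanujan's sum
`Σ_g σ_g ζ_n = μ(n)`, file E-A). [cite: KimNakamura2020, Prop. 3.5] -/
theorem sum_tmul_sigma_zeta_smul_sum_single (c : ℤ_[p]) :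
    ∑ g : (ZMod n)ˣ, (((c • ∑ h : (ZMod n)ˣ, MonoidAlgebra.single h (1 : ℤ_[p])).coeff g : ℤ_[p]) :
        ℚ_[p]) ⊗ₜ[ℚ] sigma n g (IsCyclotomicExtension.zeta n ℚ (CyclotomicField n ℚ)) =
      ((c : ℚ_[p]) * (ArithmeticFunction.moebius n : ℚ_[p])) ⊗ₜ[ℚ] (1 : CyclotomicField n ℚ) := by
  have hc : ∀ g : (ZMod n)ˣ,
      (c • ∑ h : (ZMod n)ˣ, MonoidAlgebra.single h (1 : ℤ_[p])).coeff g = c := by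
    intro g
    rw [MonoidAlgebra.coeff_smul_apply, MonoidAlgebra.coeff_sum, Finset.sum_apply',
      Finset.sum_eq_single g (fun h _ hne => by
        rw [MonoidAlgebra.single, MonoidAlgebra.coeff_ofCoeff, Finsupp.single_eq_of_ne hne.symm])
        (fun hg => absurd (Finset.mem_univ g) hg)]
    rw [MonoidAlgebra.single, MonoidAlgebra.coeff_ofCoeff, Finsupp.single_eq_same, smul_eq_mul, mul_one]
  simp_rw [hc]
  rw [← TensorProduct.tmul_sum, sum_units_sigma_zeta_eq_moebius, tmul_intCast_eq]

end GroupRingEval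

end Summit.BirchSwinnertonDyer.Rank1Residual.GaloisImage

end
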